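import Mathlib
import Summits.MatrixMultiplication.MatrixMultiplication.Theorems.AbelianSTPPSieveVP
import Summits.MatrixMultiplication.MatrixMultiplication.Theorems.AbelianSTPPCensusVPHereditary
import Summits.MatrixMultiplication.MatrixMultiplication.Theorems.AbelianSTPPCensusShapeCertFinal

/-!
# Route AbelianSTPPCensusVP — the order range `M ≤ 127` of crux `ShapeExclusionVP337` (stmt-MatrixMultiplication-19191), sorry-free

`shapeExclusionVP_upTo_127 : ∀ N M a b c, 2 ≤ N → M ≤ 127 → SieveAdmissibleVP M a b c → ¬ Beats (5/2) M a b c`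
— exactly the stub `stub_vp_upTo_127` of the crux's birth skeleton, PROVED from tree theorems only:
* `shapeExclusionTE_holds` (kernel certificate of the vM census to order 127, p414236): a vM-admissible beating list at
  `M ≤ 127` has `M ∈ {111,120,121,124,125,126,127}` and contains one of eleven residual 4-member sub-multisets;
* `VPRules.u11G_comp` (p416879): rule U11-G passes to sub-lists under the packing inequalities (which `SieveAdmissible` carries);
* each residual 4-list, as a bare list, violates U11-G form B at `t = 5` (`t = 4` for `{(5,5,3),(5,3,5),(3,5,5),(3,3,3)}` at 125):
  closed arithmetic, `decide`.
Hence a vP-admissible (`SieveAdmissibleVP = SieveAdmissible ∧ U11G ∧ (prime → U11P)`) list never beats 5/2 at any order ≤ 127.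
Cell mm-stpp, planner gen 7 (2026-08-26); farm-checked; to be landed `--supports stmt-MatrixMultiplication-19191` by a proposing seat.
WHAT THIS IS NOT: nothing about orders 128–337 (the certificate half of the crux); no STPP family, no ω statement.
-/

-- single-conjunct summit: the mandated namespace repeats `MatrixMultiplication`.
set_option linter.dupNamespace false

namespace Summit.MatrixMultiplication.MatrixMultiplication.Theorems

namespace AbelianSTPPCensusVP

open Finset

/-- A form-B violation of rule U11-G at one admissible `t ≥ 3` kills the list. -/
theorem not_u11G_of_formB_violation {K : ℕ} (M t : ℕ) (a b c : Fin K → ℕ) (h2 : 2 ≤ t) (h3 : 3 ≤ t)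
    (hab : t ≤ pAB a b c) (hbc : t ≤ pBC a b c) (hl : t ≤ lB a b c t)
    (hviol : ubB M a b c t + 2 * t ^ 2 < t * (pAB a b c + pBC a b c) + 1) : ¬ U11G M a b c := by
  intro h
  have := (h.1 t h2 hab hbc hl).2 h3
  omega

/-- From a residual sub-multiset pinned by `HasSubShapes` and U11-G on the whole (packed) list to U11-G on the bare residual list. -/
theorem false_of_hasSubShapes {N M : ℕ} {a b c : Fin N → ℕ} (L : List (ℕ × ℕ × ℕ))
    (hS : SieveAdmissible M a b c) (hG : U11G M a b c) (hs : HasSubShapes a b c L)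
    (hdead : ¬ U11G M (fun r => (L.get r).1) (fun r => (L.get r).2.1) (fun r => (L.get r).2.2)) : False := by
  obtain ⟨φ, hφ⟩ := hs
  have hU2 := hS.2.2.1
  have hsub := VPRules.u11G_comp φ hU2.1 hU2.2.1 hU2.2.2 hG
  have ha : (a ∘ φ) = fun r => (L.get r).1 := funext fun r => by
    have := congrArg Prod.fst (hφ r); simpa using this
  have hb : (b ∘ φ) = fun r => (L.get r).2.1 := funext fun r => by
    have := congrArg (fun p : ℕ × ℕ × ℕ => p.2.1) (hφ r); simpa using this
  have hc : (c ∘ φ) = fun r => (L.get r).2.2 := funext fun r => by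
    have := congrArg (fun p : ℕ × ℕ × ℕ => p.2.2) (hφ r); simpa using this
  rw [ha, hb, hc] at hsub
  exact hdead hsub

/-- The eleven residual lists of the T_E/127 census are U11-G-dead as bare lists (form B, `t = 5` resp. `4`). -/
theorem dead_111 : ¬ U11G 111 (fun r => (([(4,4,4),(4,4,4),(4,4,4),(3,3,3)] : List (ℕ × ℕ × ℕ)).get r).1)
    (fun r => (([(4,4,4),(4,4,4),(4,4,4),(3,3,3)] : List (ℕ × ℕ × ℕ)).get r).2.1)
    (fun r => (([(4,4,4),(4,4,4),(4,4,4),(3,3,3)] : List (ℕ × ℕ × ℕ)).get r).2.2) :=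
  not_u11G_of_formB_violation 111 5 _ _ _ (by decide) (by decide) (by decide) (by decide) (by decide) (by decide)

/-- The residual list `dead_443` violates rule U11-G (form B; a closed `decide`). [original] -/
theorem dead_443 (M : ℕ) (hM : M = 120 ∨ M = 121) :
    ¬ U11G M (fun r => (([(4,4,4),(4,4,4),(4,4,4),(4,4,3)] : List (ℕ × ℕ × ℕ)).get r).1)
    (fun r => (([(4,4,4),(4,4,4),(4,4,4),(4,4,3)] : List (ℕ × ℕ × ℕ)).get r).2.1)
    (fun r => (([(4,4,4),(4,4,4),(4,4,4),(4,4,3)] : List (ℕ × ℕ × ℕ)).get r).2.2) := by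
  rcases hM with rfl | rfl <;>
    exact not_u11G_of_formB_violation _ 5 _ _ _ (by decide) (by decide) (by decide) (by decide) (by decide) (by decide)

/-- The residual list `dead_434` violates rule U11-G (form B; a closed `decide`). [original] -/
theorem dead_434 (M : ℕ) (hM : M = 120 ∨ M = 121) :
    ¬ U11G M (fun r => (([(4,4,4),(4,4,4),(4,4,4),(4,3,4)] : List (ℕ × ℕ × ℕ)).get r).1)
    (fun r => (([(4,4,4),(4,4,4),(4,4,4),(4,3,4)] : List (ℕ × ℕ × ℕ)).get r).2.1)
    (fun r => (([(4,4,4),(4,4,4),(4,4,4),(4,3,4)] : List (ℕ × ℕ × ℕ)).get r).2.2) := by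
  rcases hM with rfl | rfl <;>
    exact not_u11G_of_formB_violation _ 5 _ _ _ (by decide) (by decide) (by decide) (by decide) (by decide) (by decide)

/-- The residual list `dead_344` violates rule U11-G (form B; a closed `decide`). [original] -/
theorem dead_344 (M : ℕ) (hM : M = 120 ∨ M = 121) :
    ¬ U11G M (fun r => (([(4,4,4),(4,4,4),(4,4,4),(3,4,4)] : List (ℕ × ℕ × ℕ)).get r).1)
    (fun r => (([(4,4,4),(4,4,4),(4,4,4),(3,4,4)] : List (ℕ × ℕ × ℕ)).get r).2.1)
    (fun r => (([(4,4,4),(4,4,4),(4,4,4),(3,4,4)] : List (ℕ × ℕ × ℕ)).get r).2.2) := by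
  rcases hM with rfl | rfl <;>
    exact not_u11G_of_formB_violation _ 5 _ _ _ (by decide) (by decide) (by decide) (by decide) (by decide) (by decide)

/-- The residual list `dead_543` violates rule U11-G (form B; a closed `decide`). [original] -/
theorem dead_543 : ¬ U11G 124 (fun r => (([(5,4,3),(3,4,5),(4,4,4),(4,4,4)] : List (ℕ × ℕ × ℕ)).get r).1)
    (fun r => (([(5,4,3),(3,4,5),(4,4,4),(4,4,4)] : List (ℕ × ℕ × ℕ)).get r).2.1)
    (fun r => (([(5,4,3),(3,4,5),(4,4,4),(4,4,4)] : List (ℕ × ℕ × ℕ)).get r).2.2) :=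
  not_u11G_of_formB_violation 124 5 _ _ _ (by decide) (by decide) (by decide) (by decide) (by decide) (by decide)

/-- The residual list `dead_534` violates rule U11-G (form B; a closed `decide`). [original] -/
theorem dead_534 : ¬ U11G 124 (fun r => (([(5,3,4),(3,5,4),(4,4,4),(4,4,4)] : List (ℕ × ℕ × ℕ)).get r).1)
    (fun r => (([(5,3,4),(3,5,4),(4,4,4),(4,4,4)] : List (ℕ × ℕ × ℕ)).get r).2.1)
    (fun r => (([(5,3,4),(3,5,4),(4,4,4),(4,4,4)] : List (ℕ × ℕ × ℕ)).get r).2.2) :=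
  not_u11G_of_formB_violation 124 5 _ _ _ (by decide) (by decide) (by decide) (by decide) (by decide) (by decide)

/-- The residual list `dead_453` violates rule U11-G (form B; a closed `decide`). [original] -/
theorem dead_453 : ¬ U11G 124 (fun r => (([(4,5,3),(4,3,5),(4,4,4),(4,4,4)] : List (ℕ × ℕ × ℕ)).get r).1)
    (fun r => (([(4,5,3),(4,3,5),(4,4,4),(4,4,4)] : List (ℕ × ℕ × ℕ)).get r).2.1)
    (fun r => (([(4,5,3),(4,3,5),(4,4,4),(4,4,4)] : List (ℕ × ℕ × ℕ)).get r).2.2) :=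
  not_u11G_of_formB_violation 124 5 _ _ _ (by decide) (by decide) (by decide) (by decide) (by decide) (by decide)

/-- The residual list `dead_4444` violates rule U11-G (form B; a closed `decide`). [original] -/
theorem dead_4444 (M : ℕ) (hM : M = 124 ∨ M = 125 ∨ M = 126 ∨ M = 127) :
    ¬ U11G M (fun r => (([(4,4,4),(4,4,4),(4,4,4),(4,4,4)] : List (ℕ × ℕ × ℕ)).get r).1)
    (fun r => (([(4,4,4),(4,4,4),(4,4,4),(4,4,4)] : List (ℕ × ℕ × ℕ)).get r).2.1)
    (fun r => (([(4,4,4),(4,4,4),(4,4,4),(4,4,4)] : List (ℕ × ℕ × ℕ)).get r).2.2) := by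
  rcases hM with rfl | rfl | rfl | rfl <;>
    exact not_u11G_of_formB_violation _ 5 _ _ _ (by decide) (by decide) (by decide) (by decide) (by decide) (by decide)

/-- The residual list `dead_553` violates rule U11-G (form B; a closed `decide`). [original] -/
theorem dead_553 : ¬ U11G 125 (fun r => (([(5,5,3),(5,3,5),(3,5,5),(3,3,3)] : List (ℕ × ℕ × ℕ)).get r).1)
    (fun r => (([(5,5,3),(5,3,5),(3,5,5),(3,3,3)] : List (ℕ × ℕ × ℕ)).get r).2.1)
    (fun r => (([(5,5,3),(5,3,5),(3,5,5),(3,3,3)] : List (ℕ × ℕ × ℕ)).get r).2.2) :=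
  not_u11G_of_formB_violation 125 4 _ _ _ (by decide) (by decide) (by decide) (by decide) (by decide) (by decide)

/-- **Crux `ShapeExclusionVP337` on the range `M ≤ 127`** (= `stub_vp_upTo_127` of the birth skeleton), sorry-free. -/
theorem shapeExclusionVP_upTo_127 : ∀ (N M : ℕ) (a b c : Fin N → ℕ), 2 ≤ N → M ≤ 127 →
    SieveAdmissibleVP M a b c → ¬ Beats (5 / 2) M a b c := by
  intro N M a b c hN hM hVP hB
  obtain ⟨hS, hG, -⟩ := hVP
  rcases shapeExclusionTE_holds N M a b c hN hM hS hB with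
    ⟨hM', hs⟩ | ⟨hM', hs | hs | hs⟩ | ⟨hM', hs | hs | hs | hs⟩ | ⟨hM', hs | hs⟩ | ⟨hM', hs⟩
  · subst hM'; exact false_of_hasSubShapes _ hS hG hs dead_111
  · exact false_of_hasSubShapes _ hS hG hs (dead_443 M hM')
  · exact false_of_hasSubShapes _ hS hG hs (dead_434 M hM')
  · exact false_of_hasSubShapes _ hS hG hs (dead_344 M hM')
  · subst hM'; exact false_of_hasSubShapes _ hS hG hs dead_543
  · subst hM'; exact false_of_hasSubShapes _ hS hG hs dead_534
  · subst hM'; exact false_of_hasSubShapes _ hS hG hs dead_453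
  · exact false_of_hasSubShapes _ hS hG hs (dead_4444 M (Or.inl hM'))
  · exact false_of_hasSubShapes _ hS hG hs (dead_4444 M (Or.inr (Or.inl hM')))
  · subst hM'; exact false_of_hasSubShapes _ hS hG hs dead_553
  · exact false_of_hasSubShapes _ hS hG hs (dead_4444 M (Or.inr (Or.inr hM')))

end AbelianSTPPCensusVP

end Summit.MatrixMultiplication.MatrixMultiplication.Theorems
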